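import Mathlib
import HarnessLib
import Summits.ResolutionOfSingularities.ResolutionOfSingularities.Theorems.HomologicalConductorNoZenoStableAnnihilatorReduction

/-!
# Crux `Persistence` (stmt-ResolutionOfSingularities-16484), chain W4.4b — HIGMAN'S CRITERION for a
# free FROBENIUS `A`-order `R`: stable annihilators are Casimir maps `Σ_j b_j Θ b_j^∨`

Route `ResolutionOfSingularities/HomologicalConductor`.  OURS (cell res-hironaka, crux chain W4.4b,
K-C3 §H2L K4 route «Higman over `P₀`»; seat res-D-pv-058, object «U15»); nothing here is a statement
of the manuscript under review (Hironaka 2017); AI-written, weaker than expert review.  Generalises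
U14/U14′ (`…PersistenceLatticeDivisibility/Casimir/Binomial`: `R = A[z]/(zⁿ − c)`, `b_j = z^j`,
`b_j^∨ = z^{n−1−j}`) to ANY free Frobenius order.

SETTING.  `A` a commutative ring; `R` a commutative `A`-algebra, FREE over `A` with two `A`-bases
`b, bd : ι → R` (`ι` finite) DUAL under an `A`-linear form `τ : R → A`:
`τ (b i * bd j) = δ_ij` (a FROBENIUS / symmetric `A`-order; e.g. `A[z]/(zⁿ − c)` with
`τ =` top coefficient; the invariant ring `W = k[a,b,c]^{μ₆(1,2,3)}` over `P₀ = k[a⁶,b³,c²]` with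
`τ =` coefficient of the socle monomial `a⁵b²c`, bases the six monomials and their socle quotients);
`M` an `R`-module (`IsScalarTower A R M`).

* `repr_eq_form` — coordinates are values of the form: `b.repr x j = τ (bd j * x)` (and
  symmetrically `bd.repr x j = τ (b j * x)`).
* **`linearMap_apply_eq_sum_form`** (Higman coordinates): every `R`-linear `α : M → R` is
  `v ↦ Σ_j τ(α (bd j • v)) • b j`.
* **`exists_casimir_of_stablyAnnihilates`** (HIGMAN ⇒): if `c ∈ R` stably annihilates `M`, then
  `c` acts as a CASIMIR MAP: `c • v = Σ_j b j • Θ (bd j • v)` for some `A`-linear `Θ : M → M`.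
* `casimir_smul_comm` — the Casimir sum commutes with `R` (`Σ_j (r b_j) ⊗ Θ(bd_j v) =
  Σ_j b_j ⊗ Θ(bd_j r v)`, by expanding `r b_j` in `b` and `bd_i r` in `bd`).
* **`stablyAnnihilates_of_casimir`** (HIGMAN ⇐): if `M` is finitely generated projective over `A`
  and `c` acts as a Casimir map, then `c` stably annihilates `M` (through `R ⊗_A M`).

USE (K-C3 K4): for an MCM `W`-module `L`, free of rank `m` over `P₀`, «`a⁶ ∉ s-ann(L)`» is the
NON-EXISTENCE of `Θ ∈ M_m(P₀)` with `a⁶ • 1 = Σ_{j=1}^{6} B_j Θ B_j^∨` (`B_j`, `B_j^∨` the action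
matrices of the monomial basis of `W` and of its socle-dual) — a linear system over `P₀` in `m²`
unknowns, instead of a matrix-factorisation certificate over a 7-generator presentation of `W`.
[folklore]/OURS: D. G. Higman's criterion (1955) for Frobenius extensions; mechanism only.
IN-TREE PRIOR WORK: res-L1-w44b-idea-2's `…Theorems.HomologicalConductor.PersistencePencil`
(p495130) proves the same criterion for `O[z]/(zⁿ⁺¹)` in COORDINATES (`comp_eq_pencilSum`,
`exists_factor_of_pencilSum`, `pencilSum_eq_pow`, `not_pencilSum_chain`: a module is an `O`-module
with an endomorphism `Z`, a map to a free module is a pair `S, T` intertwining `Z` and the shift);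
the present files state it for the tree's `StablyAnnihilates` (ModuleCat factorisations through
arbitrary finitely generated projectives), which is the currency of CA1 / U10 / the `caⁿ` pipeline.
-/

noncomputable section

-- single-problem summit: the doubled namespace component `ResolutionOfSingularities` is forced
set_option linter.dupNamespace false

open CategoryTheory TensorProduct
open Summit.ResolutionOfSingularities.ResolutionOfSingularities.Theorems.NoZeno.SandwichCluster
open scoped TensorProduct

universe u v

namespace Summit.ResolutionOfSingularities.ResolutionOfSingularities.Theorems.HomologicalConductor.PersistenceFrobeniusHigman

variable {A : Type v} [CommRing A] {R : Type u} [CommRing R] [Algebra A R] {ι : Type} [Fintype ι]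
  [DecidableEq ι]

/-! ## Dual bases under a Frobenius form -/

omit [Fintype ι] in
/-- **Coordinates are values of the form**: if `τ (b i * bd j) = δ_ij` then `b.repr x j = τ (bd j * x)`
for every `x`. [folklore] -/
theorem repr_eq_form (b : Module.Basis ι A R) (τ : R →ₗ[A] A) (bd : ι → R)
    (hdual : ∀ i j, τ (b i * bd j) = if i = j then 1 else 0) (x : R) (j : ι) :
    b.repr x j = τ (bd j * x) := by
  suffices h : (Finsupp.lapply j) ∘ₗ b.repr.toLinearMap = τ ∘ₗ LinearMap.mulLeft A (bd j) from
    LinearMap.congr_fun h x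
  refine b.ext fun i => ?_
  simp only [LinearMap.coe_comp, Function.comp_apply, LinearEquiv.coe_coe, Finsupp.lapply_apply,
    b.repr_self, Finsupp.single_apply, LinearMap.mulLeft_apply]
  rw [mul_comm, hdual i j]

omit [Fintype ι] in
/-- Duality is symmetric (`R` is commutative). [folklore] -/
theorem dual_symm {b bd : ι → R} (τ : R →ₗ[A] A)
    (hdual : ∀ i j, τ (b i * bd j) = if i = j then 1 else 0) (i j : ι) :
    τ (bd i * b j) = if i = j then 1 else 0 := by
  rw [mul_comm, hdual j i]
  exact if_congr eq_comm rfl rfl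

omit [Fintype ι] in
/-- The symmetric statement: `bd.repr x j = τ (b j * x)` when `bd` is also a basis. [folklore] -/
theorem repr_eq_form' (b bd : Module.Basis ι A R) (τ : R →ₗ[A] A)
    (hdual : ∀ i j, τ (b i * bd j) = if i = j then 1 else 0) (x : R) (j : ι) :
    bd.repr x j = τ (b j * x) :=
  repr_eq_form bd τ b (dual_symm τ hdual) x j

/-- Expansion in the basis `b` with form coordinates: `x = Σ_j τ(bd j * x) • b j`. [folklore] -/
theorem eq_sum_form_smul (b : Module.Basis ι A R) (τ : R →ₗ[A] A) (bd : ι → R)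
    (hdual : ∀ i j, τ (b i * bd j) = if i = j then 1 else 0) (x : R) :
    x = ∑ j, τ (bd j * x) • b j := by
  conv_lhs => rw [← b.sum_repr x]
  exact Finset.sum_congr rfl fun j _ => by rw [repr_eq_form b τ bd hdual]

/-! ## HIGMAN ⇒: stable annihilators are Casimir maps -/

section Higman

variable {M : Type u} [AddCommGroup M] [Module R M] [Module A M] [IsScalarTower A R M]

omit [Fintype ι] [Module A M] [IsScalarTower A R M] in
/-- **Higman coordinates**: for an `R`-linear `α : M → R`, `b.repr (α v) j = τ (α (bd j • v))`.
[folklore] -/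
theorem repr_linearMap_eq_form (b : Module.Basis ι A R) (τ : R →ₗ[A] A) (bd : ι → R)
    (hdual : ∀ i j, τ (b i * bd j) = if i = j then 1 else 0) (α : M →ₗ[R] R) (v : M) (j : ι) :
    b.repr (α v) j = τ (α (bd j • v)) := by
  rw [repr_eq_form b τ bd hdual, ← smul_eq_mul, ← map_smul]

omit [Module A M] [IsScalarTower A R M] in
/-- **Every `R`-linear functional is a form-coordinate sum**: `α v = Σ_j τ(α (bd j • v)) • b j`.
[folklore; Higman] -/
theorem linearMap_apply_eq_sum_form (b : Module.Basis ι A R) (τ : R →ₗ[A] A) (bd : ι → R)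
    (hdual : ∀ i j, τ (b i * bd j) = if i = j then 1 else 0) (α : M →ₗ[R] R) (v : M) :
    α v = ∑ j, τ (α (bd j • v)) • b j := by
  conv_lhs => rw [← b.sum_repr (α v)]
  exact Finset.sum_congr rfl fun j _ => by rw [repr_linearMap_eq_form b τ bd hdual]

/-- **HIGMAN'S CRITERION (⇒).**  `R` a free Frobenius `A`-order (`τ (b i * bd j) = δ_ij`), `M` an
`R`-module.  If `c ∈ R` STABLY ANNIHILATES `M` (the tree's `StablyAnnihilates`: `c • 𝟙_M` factors
through a finitely generated projective `R`-module), then `c` acts on `M` as a CASIMIR MAP: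
`c • v = Σ_j b j • Θ (bd j • v)` for some `A`-linear `Θ : M → M`.  (Re-route the factorisation
through a free `Rⁿ` by a section; through `Rⁿ` it is `v ↦ Σ_l α_l(v) • w_l`; expand each `α_l` in
Higman coordinates.) [folklore; Higman 1955] -/
theorem exists_casimir_of_stablyAnnihilates (b : Module.Basis ι A R) (τ : R →ₗ[A] A) (bd : ι → R)
    (hdual : ∀ i j, τ (b i * bd j) = if i = j then 1 else 0) {c : R}
    (h : StablyAnnihilates R c (ModuleCat.of R M)) :
    ∃ Θ : M →ₗ[A] M, ∀ v : M, c • v = ∑ j, b j • Θ (bd j • v) := by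
  obtain ⟨P, hPfin, hP, ιm, π, hιπ⟩ := h
  haveI := hP
  haveI : Module.Projective R P := P.projective_of_module_projective
  obtain ⟨n, f, hf⟩ := Module.Finite.exists_fin' R P
  obtain ⟨s, hs⟩ := Module.projective_lifting_property f LinearMap.id hf
  let α : Fin n → M →ₗ[R] R := fun l => (LinearMap.proj l) ∘ₗ s ∘ₗ ιm.hom
  let w : Fin n → M := fun l => π.hom (f (fun j => if l = j then 1 else 0))
  have hcv : ∀ v : M, c • v = ∑ l, α l v • w l := by
    intro v
    have h1 : π.hom (ιm.hom v) = c • v := apply_apply_eq_smul_of_comp_eq_smul_id hιπ v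
    have h2 : ιm.hom v = f (s (ιm.hom v)) := by
      rw [← LinearMap.comp_apply, hs, LinearMap.id_apply]
    rw [← h1, h2, ← LinearMap.comp_apply, LinearMap.pi_apply_eq_sum_univ]
    rfl
  -- `λ_l := τ ∘ α_l`, `A`-linear
  let lam : Fin n → M →ₗ[A] A := fun l => τ ∘ₗ (α l).restrictScalars A
  refine ⟨∑ l : Fin n, (LinearMap.toSpanSingleton A M (w l)) ∘ₗ (lam l), fun v => ?_⟩
  rw [hcv v]
  simp only [LinearMap.sum_apply, LinearMap.coe_comp, Function.comp_apply,
    LinearMap.toSpanSingleton_apply, Finset.smul_sum]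
  rw [Finset.sum_comm]
  refine Finset.sum_congr rfl fun l _ => ?_
  rw [linearMap_apply_eq_sum_form b τ bd hdual (α l) v, Finset.sum_smul]
  refine Finset.sum_congr rfl fun j _ => ?_
  rw [smul_assoc, smul_comm]
  rfl

end Higman

/-! ## HIGMAN ⇐: Casimir maps factor through `R ⊗_A M` -/

section Casimir

variable {M : Type u} [AddCommGroup M] [Module R M] [Module A M] [IsScalarTower A R M]

/-- **The Casimir sum commutes with `R`**: for dual bases `b`, `bd` and any `A`-linear `Θ`,
`Σ_j (r * b j) ⊗ Θ (bd j • v) = Σ_j b j ⊗ Θ (bd j • (r • v))` in `R ⊗_A M` — expand `r * b j` in the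
basis `b` and `bd i * r` in the basis `bd`; the coefficients are the same values `τ (bd i * r * b j)`.
[folklore; the Casimir element is central] -/
theorem casimir_smul_comm (b bd : Module.Basis ι A R) (τ : R →ₗ[A] A)
    (hdual : ∀ i j, τ (b i * bd j) = if i = j then 1 else 0) (Θ : M →ₗ[A] M) (r : R) (v : M) :
    (∑ j, (r * b j) ⊗ₜ[A] Θ (bd j • v)) = ∑ i, b i ⊗ₜ[A] Θ (bd i • (r • v)) := by
  -- expand `r * b j = Σ_i τ(bd i * (r * b j)) • b i`
  have hL : (∑ j, (r * b j) ⊗ₜ[A] Θ (bd j • v)) =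
      ∑ j, ∑ i, b i ⊗ₜ[A] Θ ((τ (bd i * (r * b j)) • bd j) • v) := by
    refine Finset.sum_congr rfl fun j _ => ?_
    conv_lhs => rw [eq_sum_form_smul b τ bd hdual (r * b j)]
    rw [TensorProduct.sum_tmul]
    refine Finset.sum_congr rfl fun i _ => ?_
    rw [TensorProduct.smul_tmul, ← map_smul, smul_assoc]
  -- expand `bd i * r = Σ_j τ(b j * (bd i * r)) • bd j`
  have hR : (∑ i, b i ⊗ₜ[A] Θ (bd i • (r • v))) =
      ∑ i, ∑ j, b i ⊗ₜ[A] Θ ((τ (b j * (bd i * r)) • bd j) • v) := by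
    refine Finset.sum_congr rfl fun i _ => ?_
    have hx : (bd i * r) • v = ∑ j, (τ (b j * (bd i * r)) • bd j) • v := by
      conv_lhs => rw [eq_sum_form_smul bd τ b (dual_symm τ hdual) (bd i * r)]
      rw [Finset.sum_smul]
    rw [← mul_smul, hx, map_sum, TensorProduct.tmul_sum]
  rw [hL, hR, Finset.sum_comm]
  refine Finset.sum_congr rfl fun i _ => Finset.sum_congr rfl fun j _ => ?_
  rw [show bd i * (r * b j) = b j * (bd i * r) by ring]

/-- **HIGMAN'S CRITERION (⇐).**  `R` a free Frobenius `A`-order with dual bases `b`, `bd`, `M` an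
`R`-module finitely generated projective OVER `A`.  If `c ∈ R` acts as a Casimir map
`c • v = Σ_j b j • Θ (bd j • v)` (`Θ` `A`-linear), then `c` STABLY ANNIHILATES `M`: the action factors
as `M —ι→ R ⊗_A M —π→ M`, `ι(v) = Σ_j b j ⊗ Θ(bd j • v)` (`R`-linear by `casimir_smul_comm`),
`π(x ⊗ m) = x • m`. [folklore; Higman 1955] -/
theorem stablyAnnihilates_of_casimir [Module.Finite A M] [Module.Projective A M]
    (b bd : Module.Basis ι A R) (τ : R →ₗ[A] A)
    (hdual : ∀ i j, τ (b i * bd j) = if i = j then 1 else 0) (Θ : M →ₗ[A] M) (c : R)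
    (hc : ∀ v : M, c • v = ∑ j, b j • Θ (bd j • v)) :
    StablyAnnihilates R c (ModuleCat.of R M) := by
  let ι₀ : M →ₗ[A] R ⊗[A] M :=
    ∑ j, (TensorProduct.mk A R M (b j)) ∘ₗ Θ ∘ₗ ((LinearMap.lsmul R M (bd j)).restrictScalars A)
  have hι₀ : ∀ v, ι₀ v = ∑ j, b j ⊗ₜ[A] Θ (bd j • v) := by
    intro v
    simp only [ι₀, LinearMap.sum_apply, LinearMap.coe_comp, Function.comp_apply,
      TensorProduct.mk_apply, LinearMap.restrictScalars_apply, LinearMap.lsmul_apply]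
  let ιR : M →ₗ[R] R ⊗[A] M :=
    { toFun := ι₀
      map_add' := fun v w => ι₀.map_add v w
      map_smul' := fun r v => by
        rw [hι₀, hι₀, RingHom.id_apply, Finset.smul_sum]
        simp only [TensorProduct.smul_tmul', smul_eq_mul]
        exact (casimir_smul_comm b bd τ hdual Θ r v).symm }
  let π : R ⊗[A] M →ₗ[R] M := (LinearMap.id : M →ₗ[A] M).liftBaseChange R
  refine ⟨ModuleCat.of R (R ⊗[A] M), inferInstance,
    (IsProjective.iff_projective (R := R) (R ⊗[A] M)).mp inferInstance,
    ModuleCat.ofHom ιR, ModuleCat.ofHom π, ?_⟩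
  ext v
  have h1 : π (ιR v) = c • v := by
    change π (ι₀ v) = c • v
    rw [hι₀, map_sum, hc v]
    refine Finset.sum_congr rfl fun j _ => ?_
    rw [LinearMap.liftBaseChange_tmul, LinearMap.id_apply]
  simpa [ModuleCat.hom_comp, ModuleCat.hom_ofHom] using h1

/-- **HIGMAN'S CRITERION (iff)** for a free Frobenius `A`-order and an `R`-module finitely
generated projective over `A`: `c` stably annihilates `M` iff `c` acts as a Casimir map.
[folklore; Higman 1955] -/
theorem stablyAnnihilates_iff_exists_casimir [Module.Finite A M] [Module.Projective A M]
    (b bd : Module.Basis ι A R) (τ : R →ₗ[A] A)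
    (hdual : ∀ i j, τ (b i * bd j) = if i = j then 1 else 0) (c : R) :
    StablyAnnihilates R c (ModuleCat.of R M) ↔
      ∃ Θ : M →ₗ[A] M, ∀ v : M, c • v = ∑ j, b j • Θ (bd j • v) :=
  ⟨exists_casimir_of_stablyAnnihilates b τ bd hdual,
    fun ⟨Θ, hΘ⟩ => stablyAnnihilates_of_casimir b bd τ hdual Θ c hΘ⟩

end Casimir

end Summit.ResolutionOfSingularities.ResolutionOfSingularities.Theorems.HomologicalConductor.PersistenceFrobeniusHigman
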